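import Summits.QuantumFields.YangMills.Theorems.BalabanUVNodesN15KingModelSrcDivStepRows
import Summits.QuantumFields.YangMills.Theorems.BalabanUVNodesN15KingModelSrcDivCoarseJet
import HarnessLib

/-!
# BalabanUVNodes ∕ N15 — THE KING-MODEL RUNG, PROGRAMME Y, FILE 70e: ★★★ THE η-DEFECT OF THE DRESSED SOURCE-DIVERGENCE ENTRY OF THE KING JET —
# `𝔇_{kingPrV}(X′∘N′∇′*_κ, X̄∘N̄∇̄*_κ) ≤ B·(K+2)·((L^K)^{−γ∕2} + r·(L^K)^{−1∕(8(d+1))})·e^{−δ|y−y′|_T}`, HYPOTHESIS-FREE ON THE KING RUNG, UNDER THE THREE (3.35) LETTERS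

WHO ∕ WHEN.  Cell `pub-ymgap`, seat `pub-ymgap-dag-n15-d` (R134, N15 NE2 s3 = King-model rung, g22); `--kind proof --supports stmt-QuantumFields-27366 --as helper`
(K3⁸; count-neutral).  THEOREMS ONLY (0 `def`).  Assembly BY NAME of this seat's FILES 69 (`srcDiv_byParts_comp`), 70a (`srcDiv_uniform_letters`), 70b (`srcDivJet_coarse`,
`srcDivJet_fine_isUnit`), 70c–70d (`hasMaj_pull_stepMismatch`, `hasMaj_fineStep`, `hasMaj_idef_step`), dag-n15-a K-A (`kingJet_uniform_letters`, `tensorId_kingGOp_comp_symbOp_divAdj`)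
and the device `T4EtaRateDefect.idef_neumann_majorant_flat`; nothing in the tree is modified.

WHY (this seat's ARCHITECTURE NOTE «ENTRY 2 LIVE BY PARTS», pub-ymgap INBOX l.43300).  The third entry of the (3.42) jet — the dressed propagator composed with the adjoint
covariant derivative, `X∘N∇*_κ` — is the one the left-jet form cannot control at a rate (its defect would contain the bare mixed kernel's).  In the BY-PARTS form
`Y = (G∘N∇*_κ) + 𝕄Y` (FILE 69) the source `G∘N∇*_κ = kingSOp_κ ⊗ 1` has an η-defect at the rate `(L^K)^{−γ∕2}` (FILE 70a), the fine step `𝕄′` is small (FILE 70d), its defect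
against the FITTED coarse step `𝕄̄₁` is a sum of divergence-form cell-oscillation rows (rate `(L^K)^{−1∕(8(d+1))}`, FILES 64–67∕70a) and η-rate rows, and the true-versus-fitted
mismatch of the coarse run costs `L^{−K}` (FILES 70c–70d); `idef_neumann_majorant_flat` sums the Neumann series.

WHAT.  `srcDivJet_const_bound` (constants).  ★★★ `hasMaj_idef_srcDivJet_king`: for `d ≥ 1`, odd `L ≥ 3` (stated `Odd L`, `2 ≤ L`), `a > 0`, `m₀² ≥ 0`, `0 ≤ γ < 1` there are
`δ, r₀, B > 0` such that for every `K ≥ 1`, `n ≥ 1`, cube `M_μ = 2L^e`, mass `0 < m² ≤ m₀²`, direction `κ`, every `0 ≤ r ≤ r₀` and every fine first-order family `(c′, a′_μ)` with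
`|c′|, |a′_μ|, |N′∇′_{κ′}a′_μ| ≤ r`: `HasMaj (King coarse blocks) (fine unit blocks) (𝔇_{kingPrV}(X′∘N′∇′*_κ, X̄∘N̄∇̄*_κ)) (B(K+2)((L^K)^{−γ∕2} + r(L^K)^{−1∕(8(d+1))})e^{−δd})`,
`X′ = (bgPair (A₀′⁻¹⊗1) (N′∇′_μ(A₀′⁻¹⊗1))_μ c′ a′)_none` the dressed fine propagator of n15-b's (3.65) fixed point, `X̄` its coarse partner at the block-averaged letters.

HONEST FRAMING ∕ LIMITS.  King's `A = 0` MODEL + abelianised scalar-multiplier species on finite tori (template literature [King1986] (2.13)–(2.17) p.653, (4.1)–(4.5) p.670;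
[Balaban1985BackgroundPropagators] (3.35) p.396, Thm 3.1 (3.42) p.397 (third entry: SHAPE), (3.52) p.400, (3.62)–(3.65) pp.402–403: mechanism) — NOT Bałaban's covariant `G(U)`
((S3) located: no level∕profile rows for `Δ_a⁻¹` in the tree); block-averaged coarse partner (C3).  NE2⁺ NOT PRINTED ∕ NOT proved; no statement of record touched; N15 NOT discharged;
K3⁸ OPEN; counts UNMOVED (typed 28∕28 · discharged 5∕27); one finite torus per index — NOT ℝ⁴ ∕ infinite volume ∕ OS ∕ mass gap ∕ Clay.
-/

noncomputable section

open scoped BigOperators Matrix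
open Finset

namespace Summit.QuantumFields.YangMills.BalabanUVNodes.N15.KingModel.SrcDiv

open Literature.MathematicalPhysics.QuantumFieldTheory.Balaban1983to89
open Literature.MathematicalPhysics.QuantumFieldTheory.Balaban1983to89.B11SectG (BlockNorm HasMaj)
open Literature.MathematicalPhysics.QuantumFieldTheory.Balaban1983to89.B6RandomWalk (Triangle254)
open Literature.MathematicalPhysics.QuantumFieldTheory.Balaban1983to89.B9SectDWeightedNeumann (WRow wrow_of_exp)
open Literature.MathematicalPhysics.QuantumFieldTheory.Balaban1983to89.T4EtaRateDefect (idef idef_apply idef_neumann_majorant_flat)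
open Literature.MathematicalPhysics.QuantumFieldTheory.Balaban1983to89.T4EtaRateCoeffDefect (pull pull_apply blockAvg)
open Literature.MathematicalPhysics.QuantumFieldTheory.Balaban1983to89.B6Prop26Gluing (mulOp)
open Literature.MathematicalPhysics.QuantumFieldTheory.Balaban1983to89.B5Prop11Plancherel (Tor fine unitVec)
open Literature.MathematicalPhysics.QuantumFieldTheory.King1986.Torus (blockOf tdistT tdistT_nonneg tdistT_triangle)
open Literature.MathematicalPhysics.QuantumFieldTheory.Balaban1983to89.B6UnitTorusCarrier (unitTorusGeo rowSum_unitTorusGeo unitTorusGeo_dist)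
open Summit.QuantumFields.YangMills.BalabanUVNodes.N15.VectorPiece (kingPrV blkFine tensorId bshiftEquiv)
open Summit.QuantumFields.YangMills.BalabanUVNodes.N15.BackgroundLayer (fgrad projO bgPair stack unstack abs_blockAvg_le)
open Summit.QuantumFields.YangMills.BalabanUVNodes.N15.TwoGrid (symbOp sD sTinv)
open Summit.QuantumFields.YangMills.BalabanUVNodes.N15.TwoGrid.KingJet (kingJet_uniform_letters tensorId_kingGOp_comp_symbOp_divAdj hasMaj_weaken hasMaj_weaken₂)
open Summit.QuantumFields.YangMills.BalabanUVNodes.N15.BackgroundModel (kappa_ofBlocks)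
open Summit.QuantumFields.YangMills.BalabanUVNodes.N15.DerivDefect (exists_const_hasMaj_ofBlocks)
open Summit.QuantumFields.YangMills.BalabanUVNodes.N15KingModelRung.Curved (kingGOp kingSOp)

variable {d : ℕ} (L : ℕ) [NeZero L]

/-! ## §1 Constants -/

omit [NeZero L] in
/-- The device's output constant against `B·(K+2)·(θ + r·x)`: source defect `βθ` + transported mismatch `(d+1)βc rA₀((2e^δ+3)L^{−K} + 2θ)` + step-defect term
`βr((d+2)(L^{−K}+θ) + (d+1)(x+θ))·c·A₀`, `A₀ = B₂(K+2)`, inverse guard `q ≤ 2`, `r ≤ 1`, `L^{−K} ≤ x`. [folklore] -/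
theorem srcDivJet_const_bound {β c B₂ E θ x r il dd Kp q : ℝ} (hβ : 0 ≤ β) (hc : 0 ≤ c) (hB₂ : 0 ≤ B₂) (hE : 0 ≤ E) (hθ : 0 ≤ θ) (hx : 0 ≤ x)
    (hr : 0 ≤ r) (hr1 : r ≤ 1) (hil : 0 ≤ il) (hilx : il ≤ x) (hdd : 0 ≤ dd) (hKp : 1 ≤ Kp) (hq0 : 0 ≤ q) (hq2 : q ≤ 2) :
    (β * θ + (dd + 1) * (β * c * r * (B₂ * Kp) * ((2 * E + 3) * il + 2 * θ))
        + 1 * (β * r * ((dd + 2) * (il + θ) + (dd + 1) * (x + θ)) * c) * (B₂ * Kp)) * q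
      ≤ (2 * β + 2 * (dd + 1) * β * c * B₂ * (2 * E + 3) + 2 * β * c * B₂ * (2 * dd + 3) + 1) * Kp * (θ + r * x) := by
  have hU0 : 0 ≤ θ + r * x := by positivity
  have h1 : r * il ≤ r * x := mul_le_mul_of_nonneg_left hilx hr
  have h2 : r * θ ≤ θ := mul_le_of_le_one_left hθ hr1
  have hKU : θ + r * x ≤ Kp * (θ + r * x) := le_mul_of_one_le_left hU0 hKp
  have hKp0 : 0 ≤ Kp := by linarith
  have hrx : 0 ≤ r * x := mul_nonneg hr hx
  have hT1 : β * θ ≤ β * (Kp * (θ + r * x)) := mul_le_mul_of_nonneg_left (by linarith) hβ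
  have hin2 : (2 * E + 3) * (r * il) + 2 * (r * θ) ≤ (2 * E + 3) * (θ + r * x) := by
    have := mul_le_mul_of_nonneg_left h1 (by linarith : (0 : ℝ) ≤ 2 * E + 3)
    nlinarith
  have hT2 : (dd + 1) * (β * c * r * (B₂ * Kp) * ((2 * E + 3) * il + 2 * θ)) ≤ (dd + 1) * β * c * B₂ * (2 * E + 3) * (Kp * (θ + r * x)) := by
    calc (dd + 1) * (β * c * r * (B₂ * Kp) * ((2 * E + 3) * il + 2 * θ))
        = ((dd + 1) * β * c * B₂ * Kp) * ((2 * E + 3) * (r * il) + 2 * (r * θ)) := by ring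
      _ ≤ ((dd + 1) * β * c * B₂ * Kp) * ((2 * E + 3) * (θ + r * x)) := mul_le_mul_of_nonneg_left hin2 (by positivity)
      _ = _ := by ring
  have hin3 : (dd + 2) * (r * il + r * θ) + (dd + 1) * (r * x + r * θ) ≤ (2 * dd + 3) * (θ + r * x) := by nlinarith
  have hT3 : 1 * (β * r * ((dd + 2) * (il + θ) + (dd + 1) * (x + θ)) * c) * (B₂ * Kp) ≤ β * c * B₂ * (2 * dd + 3) * (Kp * (θ + r * x)) := by
    calc 1 * (β * r * ((dd + 2) * (il + θ) + (dd + 1) * (x + θ)) * c) * (B₂ * Kp)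
        = (β * c * B₂ * Kp) * ((dd + 2) * (r * il + r * θ) + (dd + 1) * (r * x + r * θ)) := by ring
      _ ≤ (β * c * B₂ * Kp) * ((2 * dd + 3) * (θ + r * x)) := mul_le_mul_of_nonneg_left hin3 (by positivity)
      _ = _ := by ring
  have hS0 : 0 ≤ β * θ + (dd + 1) * (β * c * r * (B₂ * Kp) * ((2 * E + 3) * il + 2 * θ))
      + 1 * (β * r * ((dd + 2) * (il + θ) + (dd + 1) * (x + θ)) * c) * (B₂ * Kp) := by positivity
  have hKU0 : 0 ≤ Kp * (θ + r * x) := by positivity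
  calc (β * θ + (dd + 1) * (β * c * r * (B₂ * Kp) * ((2 * E + 3) * il + 2 * θ))
          + 1 * (β * r * ((dd + 2) * (il + θ) + (dd + 1) * (x + θ)) * c) * (B₂ * Kp)) * q
      ≤ (β * (Kp * (θ + r * x)) + (dd + 1) * β * c * B₂ * (2 * E + 3) * (Kp * (θ + r * x)) + β * c * B₂ * (2 * dd + 3) * (Kp * (θ + r * x))) * 2 :=
        mul_le_mul (by linarith) hq2 hq0 (by positivity)
    _ = (2 * β + 2 * (dd + 1) * β * c * B₂ * (2 * E + 3) + 2 * β * c * B₂ * (2 * dd + 3)) * Kp * (θ + r * x) := by ring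
    _ ≤ _ := by nlinarith

variable (d)

set_option maxHeartbeats 1600000 in
/-- ★★★ **THE η-DEFECT OF THE DRESSED SOURCE-DIVERGENCE ENTRY OF THE KING JET, HYPOTHESIS-FREE ON THE KING RUNG.**  See the module docstring (WHAT).  Device:
`T4EtaRateDefect.idef_neumann_majorant_flat` at `ρ = σ = δ∕2` with fine step `K′ = 𝕄′` (FILE 69's by-parts step), coarse step `K = 𝕄̄₁` (the FITTED letters), coarse source
`S = Ȳ − 𝕄̄₁Ȳ` (so `𝔇(S′, S) = 𝔇(G′N′∇′*_κ, ḠN̄∇̄*_κ) − P(𝕄̄ − 𝕄̄₁)Ȳ`: FILE 70a (3) + FILE 70d §1), `hK′` = FILE 70d §2, `hDK` = FILE 70d §3, `hA` = FILE 70b (ii), both (3.65) units from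
FILE 70b; window `r₀ = min(r₂, r₃, (2β(2d+3)c_r + 1)⁻¹)`. [cite: Balaban1985BackgroundPropagators, (3.35) p.396 (letters), Thm 3.1 (3.42) p.397 (third entry: shape), (3.52) p.400,
(3.62)–(3.65) pp.402–403 (mechanism); King1986, (2.13)–(2.17) p.653, Prop. 3.8 (3.71) p.664, Prop. 3.9 (3.73) p.665, (4.42) p.675; Balaban1984PropagatorsII, Lemma 2.1 (2.61) p.234] -/
theorem hasMaj_idef_srcDivJet_king (hd : 1 ≤ d) (hLodd : Odd L) (hL : 2 ≤ L) {a : ℝ} (ha : 0 < a) {m0sq : ℝ} (hm0 : 0 ≤ m0sq) {γ : ℝ} (hγ0 : 0 ≤ γ) (hγ1 : γ < 1) :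
    ∃ δ r₀ B : ℝ, 0 < δ ∧ 0 < r₀ ∧ 0 < B ∧ ∀ (K : ℕ), 1 ≤ K → ∀ (n : ℕ), 1 ≤ n → ∀ (e : ℕ) (M : Fin (d + 1) → ℕ) [∀ μ, NeZero (M μ)], (∀ μ, M μ = 2 * L ^ e) →
      ∀ (msq : ℝ), 0 < msq → msq ≤ m0sq → ∀ (κ : Fin (d + 1)) (r : ℝ), 0 ≤ r → r ≤ r₀ →
      ∀ (c' : Tor (fine (L ^ n * L ^ K) M) × Fin (d + 1) → ℝ) (a' : Fin (d + 1) → Tor (fine (L ^ n * L ^ K) M) × Fin (d + 1) → ℝ),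
      (∀ z, |c' z| ≤ r) → (∀ μ z, |a' μ z| ≤ r) → (∀ μ κ' z, |fgrad ((L ^ n * L ^ K : ℕ) : ℝ) (bshiftEquiv M (L ^ n * L ^ K) κ') (a' μ) z| ≤ r) →
      HasMaj (BlockNorm.ofBlocks (unitTorusGeo L K M) (blkFine L K M))
        (BlockNorm.ofBlocks (unitTorusGeo L K M) (fun i : Tor (fine (L ^ n * L ^ K) M) × Fin (d + 1) => blockOf (L ^ n * L ^ K) M i.1))
        (idef (pull (kingPrV L K n M)) (pull (kingPrV L K n M))
          ((projO none ∘ₗ bgPair (tensorId (Fin (d + 1)) (kingGOp L a msq (K + n) (L ^ n * L ^ K) M))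
              (fun μ => symbOp M (L ^ n * L ^ K) (sD M (L ^ n * L ^ K) μ ((L ^ n * L ^ K : ℕ) : ℝ)) ∘ₗ tensorId (Fin (d + 1)) (kingGOp L a msq (K + n) (L ^ n * L ^ K) M))
              c' a') ∘ₗ
            symbOp M (L ^ n * L ^ K) (((L ^ n * L ^ K : ℕ) : ℝ) • (sTinv M (L ^ n * L ^ K) κ - 1)))
          ((projO none ∘ₗ bgPair (tensorId (Fin (d + 1)) (kingGOp L a msq K (L ^ K) M))
              (fun μ => symbOp M (L ^ K) (sD M (L ^ K) μ ((L ^ K : ℕ) : ℝ)) ∘ₗ tensorId (Fin (d + 1)) (kingGOp L a msq K (L ^ K) M))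
              (blockAvg (kingPrV L K n M) c') (fun μ => blockAvg (kingPrV L K n M) (a' μ))) ∘ₗ
            symbOp M (L ^ K) (((L ^ K : ℕ) : ℝ) • (sTinv M (L ^ K) κ - 1))))
        (fun y y' => B * (((K : ℕ) : ℝ) + 2) * (((L : ℝ) ^ K) ^ (-(γ / 2)) + r * ((L ^ K : ℕ) : ℝ) ^ (-(1 / (8 * ((d : ℝ) + 1))))) *
          Real.exp (-(δ * tdistT M y y'))) := by
  obtain ⟨δ₀, β₀, hδ₀, hβ₀, HA⟩ := kingJet_uniform_letters d L hd hLodd hL ha hm0 hγ0 hγ1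
  obtain ⟨δ₁, β₁, hδ₁, hβ₁, HY⟩ := srcDiv_uniform_letters d L hLodd hL ha hm0 hγ0 hγ1
  obtain ⟨δ₂, r₂, B₂, hδ₂, hr₂, hB₂, HC⟩ := srcDivJet_coarse d L hd hLodd hL ha hm0
  obtain ⟨r₃, hr₃, HF⟩ := srcDivJet_fine_isUnit d L hd hLodd hL ha hm0
  -- one rate, one constant, one window
  obtain ⟨δ, hδ_def⟩ : ∃ δ : ℝ, δ = min δ₀ (min δ₁ δ₂) := ⟨_, rfl⟩
  have hδ : 0 < δ := by rw [hδ_def]; exact lt_min hδ₀ (lt_min hδ₁ hδ₂)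
  have e₀ : δ ≤ δ₀ := by rw [hδ_def]; exact min_le_left _ _
  have e₁ : δ ≤ δ₁ := by rw [hδ_def]; exact (min_le_right _ _).trans (min_le_left _ _)
  have e₂ : δ ≤ δ₂ := by rw [hδ_def]; exact (min_le_right _ _).trans (min_le_right _ _)
  obtain ⟨β, hβ_def⟩ : ∃ β : ℝ, β = β₀ + β₁ := ⟨_, rfl⟩
  have hβ : 0 < β := by rw [hβ_def]; positivity
  have b₀ : β₀ ≤ β := by rw [hβ_def]; linarith
  have b₁ : β₁ ≤ β := by rw [hβ_def]; linarith
  have hσ : 0 < δ / 2 := by positivity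
  obtain ⟨cr, hcr_def⟩ : ∃ cr : ℝ, cr = B4Sect5Proof.latticeConst (d + 1) (δ / 2) := ⟨_, rfl⟩
  have hcr : 0 ≤ cr := by rw [hcr_def]; exact B4Sect5Proof.latticeConst_nonneg (d + 1) hσ.le
  obtain ⟨W, hW_def⟩ : ∃ W : ℝ, W = β * (2 * (d : ℝ) + 3) * cr := ⟨_, rfl⟩
  have hW : 0 ≤ W := by rw [hW_def]; positivity
  obtain ⟨r₀, hr₀_def⟩ : ∃ r₀ : ℝ, r₀ = min (min r₂ r₃) (2 * W + 1)⁻¹ := ⟨_, rfl⟩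
  have hr₀ : 0 < r₀ := by rw [hr₀_def]; exact lt_min (lt_min hr₂ hr₃) (by positivity)
  obtain ⟨Bt, hBt_def⟩ : ∃ Bt : ℝ, Bt = 2 * β + 2 * ((d : ℝ) + 1) * β * cr * B₂ * (2 * Real.exp δ + 3) + 2 * β * cr * B₂ * (2 * (d : ℝ) + 3) + 1 := ⟨_, rfl⟩
  have hBt : 0 < Bt := by rw [hBt_def]; positivity
  refine ⟨δ / 2, r₀, Bt, hσ, hr₀, hBt, ?_⟩
  intro K hK n hn e M _ hM msq hmsq hcap κ r hr hrr₀ c' a' hc' ha' hfa'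
  -- the window
  have hr_2 : r ≤ r₂ := hrr₀.trans (by rw [hr₀_def]; exact (min_le_left _ _).trans (min_le_left _ _))
  have hr_3 : r ≤ r₃ := hrr₀.trans (by rw [hr₀_def]; exact (min_le_left _ _).trans (min_le_right _ _))
  have hr_W : r ≤ (2 * W + 1)⁻¹ := hrr₀.trans (by rw [hr₀_def]; exact min_le_right _ _)
  have hr1 : r ≤ 1 := hr_W.trans (inv_le_one_of_one_le₀ (by linarith))
  -- geometry and arithmetic of the torus
  have hdd : ∀ a b : (unitTorusGeo L K M).Site, 0 ≤ (unitTorusGeo L K M).dist a b := fun a b => tdistT_nonneg M a b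
  have htri : Triangle254 (unitTorusGeo L K M) := fun a b c => tdistT_triangle M a b c
  have hrow := rowSum_unitTorusGeo L K M hσ
  rw [← hcr_def] at hrow
  have hL0 : 0 < L := Nat.pos_of_ne_zero (NeZero.ne L)
  have hLK1 : (1 : ℝ) ≤ ((L ^ K : ℕ) : ℝ) := by exact_mod_cast Nat.one_le_pow K L hL0
  have hM2 : ∀ μ, 2 ≤ fine (L ^ K) M μ := fun μ => by
    show 2 ≤ L ^ K * M μ
    rw [hM μ]
    have h1 : 1 ≤ L ^ K := Nat.one_le_pow _ _ hL0
    have h2 : 1 ≤ L ^ e := Nat.one_le_pow _ _ hL0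
    nlinarith
  have hθ : 0 ≤ ((L : ℝ) ^ K) ^ (-(γ / 2)) := Real.rpow_nonneg (by positivity) _
  have hx : 0 ≤ ((L ^ K : ℕ) : ℝ) ^ (-(1 / (8 * ((d : ℝ) + 1)))) := Real.rpow_nonneg (by positivity) _
  have hil : 0 ≤ (((L ^ K : ℕ) : ℝ))⁻¹ := inv_nonneg.mpr (by positivity)
  have hilx : (((L ^ K : ℕ) : ℝ))⁻¹ ≤ ((L ^ K : ℕ) : ℝ) ^ (-(1 / (8 * ((d : ℝ) + 1)))) := by
    rw [← Real.rpow_neg_one]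
    refine Real.rpow_le_rpow_of_exponent_le hLK1 (neg_le_neg ?_)
    rw [div_le_one (by positivity)]
    have : (0 : ℝ) ≤ d := Nat.cast_nonneg d
    linarith
  have hKp : (1 : ℝ) ≤ ((K : ℕ) : ℝ) + 2 := by have := (Nat.cast_nonneg K : (0 : ℝ) ≤ K); linarith
  -- the block-averaged letters
  have hcb : ∀ q, |blockAvg (kingPrV L K n M) c' q| ≤ r := abs_blockAvg_le (kingPrV L K n M) hr hc'
  have hab : ∀ μ q, |blockAvg (kingPrV L K n M) (a' μ) q| ≤ r := fun μ => abs_blockAvg_le (kingPrV L K n M) hr (ha' μ)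
  -- the letters of programmes K-A ∕ Y and the dressed coarse rows
  obtain ⟨-, -, hG'₀, -, hDG₀, -, hrows⟩ := HA K hK n hn e M hM msq hmsq hcap
  obtain ⟨-, hSf₀, hDS₀, hFc₀, hFf₀, hDF₀, hFo₀, -⟩ := HY K hK n hn e M hM msq hmsq hcap
  obtain ⟨hunitc, hYc, hDYc⟩ := HC K hK n hn e M hM msq hmsq hcap r hr hr_2 (blockAvg (kingPrV L K n M) c') (fun μ => blockAvg (kingPrV L K n M) (a' μ)) hcb hab
  have hunitf := HF K hK n hn e M hM msq hmsq hcap r hr hr_3 c' a' hc' ha'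
  -- names: fronts, jets, steps
  obtain ⟨G', hG'⟩ : ∃ G', G' = tensorId (Fin (d + 1)) (kingGOp L a msq (K + n) (L ^ n * L ^ K) M) := ⟨_, rfl⟩
  obtain ⟨Gc, hGc⟩ : ∃ Gc, Gc = tensorId (Fin (d + 1)) (kingGOp L a msq K (L ^ K) M) := ⟨_, rfl⟩
  rw [← hG'] at hG'₀ hDG₀ hrows hunitf
  rw [← hGc] at hDG₀ hunitc hYc hDYc
  rw [← hG', ← hGc]
  obtain ⟨Y', hY'⟩ : ∃ Y', Y' = (projO none ∘ₗ bgPair G' (fun μ => symbOp M (L ^ n * L ^ K) (sD M (L ^ n * L ^ K) μ ((L ^ n * L ^ K : ℕ) : ℝ)) ∘ₗ G') c' a') ∘ₗ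
      symbOp M (L ^ n * L ^ K) (((L ^ n * L ^ K : ℕ) : ℝ) • (sTinv M (L ^ n * L ^ K) κ - 1)) := ⟨_, rfl⟩
  obtain ⟨Y, hY⟩ : ∃ Y, Y = (projO none ∘ₗ bgPair Gc (fun μ => symbOp M (L ^ K) (sD M (L ^ K) μ ((L ^ K : ℕ) : ℝ)) ∘ₗ Gc)
      (blockAvg (kingPrV L K n M) c') (fun μ => blockAvg (kingPrV L K n M) (a' μ))) ∘ₗ symbOp M (L ^ K) (((L ^ K : ℕ) : ℝ) • (sTinv M (L ^ K) κ - 1)) := ⟨_, rfl⟩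
  rw [← hY', ← hY]
  -- the (3.65) fixed points in by-parts form (FILE 69)
  have hfix' := srcDiv_byParts_comp (L ^ n * L ^ K) M hunitf (symbOp M (L ^ n * L ^ K) (((L ^ n * L ^ K : ℕ) : ℝ) • (sTinv M (L ^ n * L ^ K) κ - 1)))
  rw [← hY'] at hfix'
  have hfixc := srcDiv_byParts_comp (L ^ K) M hunitc (symbOp M (L ^ K) (((L ^ K : ℕ) : ℝ) • (sTinv M (L ^ K) κ - 1)))
  rw [← hY] at hfixc
  obtain ⟨Mf, hMf⟩ : ∃ Mf, Mf = G' ∘ₗ mulOp (fun p : Tor (fine (L ^ n * L ^ K) M) × Fin (d + 1) =>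
        c' p - ∑ μ, ((L ^ n * L ^ K : ℕ) : ℝ) * (a' μ p - a' μ (p.1 - unitVec (fine (L ^ n * L ^ K) M) μ, p.2)))
      + ∑ μ, (G' ∘ₗ symbOp M (L ^ n * L ^ K) (sD M (L ^ n * L ^ K) μ ((L ^ n * L ^ K : ℕ) : ℝ))) ∘ₗ
          mulOp (fun p : Tor (fine (L ^ n * L ^ K) M) × Fin (d + 1) => a' μ (p.1 - unitVec (fine (L ^ n * L ^ K) M) μ, p.2)) := ⟨_, rfl⟩
  rw [← hMf] at hfix'
  obtain ⟨Mc, hMc⟩ : ∃ Mc, Mc = Gc ∘ₗ mulOp (fun p : Tor (fine (L ^ K) M) × Fin (d + 1) => blockAvg (kingPrV L K n M) c' p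
        - ∑ μ, ((L ^ K : ℕ) : ℝ) * (blockAvg (kingPrV L K n M) (a' μ) p - blockAvg (kingPrV L K n M) (a' μ) (p.1 - unitVec (fine (L ^ K) M) μ, p.2)))
      + ∑ μ, (Gc ∘ₗ symbOp M (L ^ K) (sD M (L ^ K) μ ((L ^ K : ℕ) : ℝ))) ∘ₗ
          mulOp (fun p : Tor (fine (L ^ K) M) × Fin (d + 1) => blockAvg (kingPrV L K n M) (a' μ) (p.1 - unitVec (fine (L ^ K) M) μ, p.2)) := ⟨_, rfl⟩
  rw [← hMc] at hfixc
  obtain ⟨Mc1, hMc1⟩ : ∃ Mc1, Mc1 = Gc ∘ₗ mulOp (blockAvg (kingPrV L K n M) (fun p : Tor (fine (L ^ n * L ^ K) M) × Fin (d + 1) =>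
        c' p - ∑ μ, ((L ^ n * L ^ K : ℕ) : ℝ) * (a' μ p - a' μ (p.1 - unitVec (fine (L ^ n * L ^ K) M) μ, p.2))))
      + ∑ μ, (Gc ∘ₗ symbOp M (L ^ K) (sD M (L ^ K) μ ((L ^ K : ℕ) : ℝ))) ∘ₗ
          mulOp (blockAvg (kingPrV L K n M) (fun p : Tor (fine (L ^ n * L ^ K) M) × Fin (d + 1) => a' μ (p.1 - unitVec (fine (L ^ n * L ^ K) M) μ, p.2))) := ⟨_, rfl⟩
  -- the rows at the common `(δ, β)`
  have hG'f : HasMaj (BlockNorm.ofBlocks (unitTorusGeo L K M) (fun i : Tor (fine (L ^ n * L ^ K) M) × Fin (d + 1) => blockOf (L ^ n * L ^ K) M i.1))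
      (BlockNorm.ofBlocks (unitTorusGeo L K M) (fun i : Tor (fine (L ^ n * L ^ K) M) × Fin (d + 1) => blockOf (L ^ n * L ^ K) M i.1)) G'
      (fun y y' => β * Real.exp (-(δ * tdistT M y y'))) := hasMaj_weaken L hβ₀.le b₀ e₀ hG'₀
  have hS' : ∀ μ, HasMaj (BlockNorm.ofBlocks (unitTorusGeo L K M) (fun i : Tor (fine (L ^ n * L ^ K) M) × Fin (d + 1) => blockOf (L ^ n * L ^ K) M i.1))
      (BlockNorm.ofBlocks (unitTorusGeo L K M) (fun i : Tor (fine (L ^ n * L ^ K) M) × Fin (d + 1) => blockOf (L ^ n * L ^ K) M i.1))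
      (G' ∘ₗ symbOp M (L ^ n * L ^ K) (((L ^ n * L ^ K : ℕ) : ℝ) • (sTinv M (L ^ n * L ^ K) μ - 1))) (fun y y' => β * Real.exp (-(δ * tdistT M y y'))) := fun μ => by
    rw [hG', tensorId_kingGOp_comp_symbOp_divAdj]
    exact hasMaj_weaken L hβ₁.le b₁ e₁ (hSf₀ μ)
  have hSf : ∀ μ, HasMaj (BlockNorm.ofBlocks (unitTorusGeo L K M) (fun i : Tor (fine (L ^ n * L ^ K) M) × Fin (d + 1) => blockOf (L ^ n * L ^ K) M i.1))
      (BlockNorm.ofBlocks (unitTorusGeo L K M) (fun i : Tor (fine (L ^ n * L ^ K) M) × Fin (d + 1) => blockOf (L ^ n * L ^ K) M i.1))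
      (G' ∘ₗ symbOp M (L ^ n * L ^ K) (sD M (L ^ n * L ^ K) μ ((L ^ n * L ^ K : ℕ) : ℝ))) (fun y y' => β * Real.exp (-(δ * tdistT M y y'))) := fun μ => by
    rw [hG', tensorId_kingGOp_comp_symbOp_sD]
    exact hasMaj_weaken L hβ₁.le b₁ e₁ (hFf₀ μ)
  have hSc : ∀ μ, HasMaj (BlockNorm.ofBlocks (unitTorusGeo L K M) (blkFine L K M)) (BlockNorm.ofBlocks (unitTorusGeo L K M) (blkFine L K M))
      (Gc ∘ₗ symbOp M (L ^ K) (sD M (L ^ K) μ ((L ^ K : ℕ) : ℝ))) (fun y y' => β * Real.exp (-(δ * tdistT M y y'))) := fun μ => by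
    rw [hGc, tensorId_kingGOp_comp_symbOp_sD]
    exact hasMaj_weaken L hβ₁.le b₁ e₁ (hFc₀ μ)
  have hDG : HasMaj (BlockNorm.ofBlocks (unitTorusGeo L K M) (blkFine L K M))
      (BlockNorm.ofBlocks (unitTorusGeo L K M) (fun i : Tor (fine (L ^ n * L ^ K) M) × Fin (d + 1) => blockOf (L ^ n * L ^ K) M i.1))
      (idef (pull (kingPrV L K n M)) (pull (kingPrV L K n M)) G' Gc) (fun y y' => β * ((L : ℝ) ^ K) ^ (-(γ / 2)) * Real.exp (-(δ * tdistT M y y'))) :=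
    hasMaj_weaken₂ L hβ₀.le b₀ hθ e₀ hDG₀
  have hGo : ∀ (g : Tor (fine (L ^ n * L ^ K) M) × Fin (d + 1) → ℝ) (s : ℝ), 0 ≤ s → (∀ p, |g p| ≤ s) →
      HasMaj (BlockNorm.ofBlocks (unitTorusGeo L K M) (blkFine L K M))
        (BlockNorm.ofBlocks (unitTorusGeo L K M) (fun i : Tor (fine (L ^ n * L ^ K) M) × Fin (d + 1) => blockOf (L ^ n * L ^ K) M i.1))
        (G' ∘ₗ idef (pull (kingPrV L K n M)) (pull (kingPrV L K n M)) (mulOp g) (mulOp (blockAvg (kingPrV L K n M) g)))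
        (fun y y' => β * s * (((L ^ K : ℕ) : ℝ))⁻¹ * Real.exp (-(δ * tdistT M y y'))) := fun g s hs hg =>
    hasMaj_weaken₂ L (by positivity) (mul_le_mul_of_nonneg_right b₀ hs) hil e₀ (hrows g s hs hg).1
  have hDSf : ∀ μ, HasMaj (BlockNorm.ofBlocks (unitTorusGeo L K M) (blkFine L K M))
      (BlockNorm.ofBlocks (unitTorusGeo L K M) (fun i : Tor (fine (L ^ n * L ^ K) M) × Fin (d + 1) => blockOf (L ^ n * L ^ K) M i.1))
      (idef (pull (kingPrV L K n M)) (pull (kingPrV L K n M)) (G' ∘ₗ symbOp M (L ^ n * L ^ K) (sD M (L ^ n * L ^ K) μ ((L ^ n * L ^ K : ℕ) : ℝ)))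
        (Gc ∘ₗ symbOp M (L ^ K) (sD M (L ^ K) μ ((L ^ K : ℕ) : ℝ))))
      (fun y y' => β * ((L : ℝ) ^ K) ^ (-(γ / 2)) * Real.exp (-(δ * tdistT M y y'))) := fun μ => by
    rw [hG', hGc, tensorId_kingGOp_comp_symbOp_sD, tensorId_kingGOp_comp_symbOp_sD]
    exact hasMaj_weaken₂ L hβ₁.le b₁ hθ e₁ (hDF₀ μ)
  have hSfc : ∀ (μ : Fin (d + 1)) (g : Tor (fine (L ^ n * L ^ K) M) × Fin (d + 1) → ℝ) (s : ℝ), 0 ≤ s → (∀ p, |g p| ≤ s) →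
      HasMaj (BlockNorm.ofBlocks (unitTorusGeo L K M) (blkFine L K M))
        (BlockNorm.ofBlocks (unitTorusGeo L K M) (fun i : Tor (fine (L ^ n * L ^ K) M) × Fin (d + 1) => blockOf (L ^ n * L ^ K) M i.1))
        ((G' ∘ₗ symbOp M (L ^ n * L ^ K) (sD M (L ^ n * L ^ K) μ ((L ^ n * L ^ K : ℕ) : ℝ))) ∘ₗ
          idef (pull (kingPrV L K n M)) (pull (kingPrV L K n M)) (mulOp g) (mulOp (blockAvg (kingPrV L K n M) g)))
        (fun y y' => β * s * ((L ^ K : ℕ) : ℝ) ^ (-(1 / (8 * ((d : ℝ) + 1)))) * Real.exp (-(δ * tdistT M y y'))) := fun μ g s hs hg => by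
    rw [hG', tensorId_kingGOp_comp_symbOp_sD]
    exact hasMaj_weaken₂ L (by positivity) (mul_le_mul_of_nonneg_right b₁ hs) hx e₁ (hFo₀ μ g s hs hg)
  have h3 : HasMaj (BlockNorm.ofBlocks (unitTorusGeo L K M) (blkFine L K M))
      (BlockNorm.ofBlocks (unitTorusGeo L K M) (fun i : Tor (fine (L ^ n * L ^ K) M) × Fin (d + 1) => blockOf (L ^ n * L ^ K) M i.1))
      (idef (pull (kingPrV L K n M)) (pull (kingPrV L K n M)) (G' ∘ₗ symbOp M (L ^ n * L ^ K) (((L ^ n * L ^ K : ℕ) : ℝ) • (sTinv M (L ^ n * L ^ K) κ - 1)))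
        (Gc ∘ₗ symbOp M (L ^ K) (((L ^ K : ℕ) : ℝ) • (sTinv M (L ^ K) κ - 1))))
      (fun y y' => β * ((L : ℝ) ^ K) ^ (-(γ / 2)) * Real.exp (-(δ / 2 * tdistT M y y'))) := by
    rw [hG', hGc, tensorId_kingGOp_comp_symbOp_divAdj, tensorId_kingGOp_comp_symbOp_divAdj]
    exact hasMaj_weaken₂ L hβ₁.le b₁ hθ (by linarith) (hDS₀ κ)
  -- the dressed coarse rows (FILE 70b) at `A₀ = B₂(K+2)`
  have hA₀ : (0 : ℝ) ≤ B₂ * ((((K : ℕ) : ℝ)) + 2) := by positivity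
  have hYκ := hYc κ
  rw [← hY] at hYκ
  have hYδ : HasMaj (BlockNorm.ofBlocks (unitTorusGeo L K M) (blkFine L K M)) (BlockNorm.ofBlocks (unitTorusGeo L K M) (blkFine L K M)) Y
      (fun y y' => B₂ * (((K : ℕ) : ℝ) + 2) * Real.exp (-(δ * tdistT M y y'))) := hasMaj_weaken L hA₀ le_rfl e₂ hYκ
  have hYρ : HasMaj (BlockNorm.ofBlocks (unitTorusGeo L K M) (blkFine L K M)) (BlockNorm.ofBlocks (unitTorusGeo L K M) (blkFine L K M)) Y
      (fun y y' => B₂ * (((K : ℕ) : ℝ) + 2) * Real.exp (-(δ / 2 * tdistT M y y'))) := hasMaj_weaken L hA₀ le_rfl (by linarith) hYκ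
  have hDYδ : ∀ μ, HasMaj (BlockNorm.ofBlocks (unitTorusGeo L K M) (blkFine L K M)) (BlockNorm.ofBlocks (unitTorusGeo L K M) (blkFine L K M))
      (symbOp M (L ^ K) (sD M (L ^ K) μ ((L ^ K : ℕ) : ℝ)) ∘ₗ Y) (fun y y' => B₂ * (((K : ℕ) : ℝ) + 2) * Real.exp (-(δ * tdistT M y y'))) := fun μ => by
    have h := hDYc κ μ
    rw [← hY] at h
    exact hasMaj_weaken L hA₀ le_rfl e₂ h
  -- the device's rows: mismatch (FILE 70d §1), fine step (§2), step defect (§3), source defect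
  have hMis : HasMaj (BlockNorm.ofBlocks (unitTorusGeo L K M) (blkFine L K M))
      (BlockNorm.ofBlocks (unitTorusGeo L K M) (fun i : Tor (fine (L ^ n * L ^ K) M) × Fin (d + 1) => blockOf (L ^ n * L ^ K) M i.1))
      (pull (kingPrV L K n M) ∘ₗ (Mc - Mc1) ∘ₗ Y)
      (fun y y' => ((d : ℝ) + 1) * (β * B4Sect5Proof.latticeConst (d + 1) (δ / 2) * r * (B₂ * (((K : ℕ) : ℝ) + 2)) *
        ((2 * Real.exp δ + 3) * (((L ^ K : ℕ) : ℝ))⁻¹ + 2 * ((L : ℝ) ^ K) ^ (-(γ / 2)))) * Real.exp (-(δ / 2 * tdistT M y y'))) := by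
    rw [hMc, hMc1]
    exact hasMaj_pull_stepMismatch L M K n hβ.le hA₀ hθ hδ hr hM2 hG'f hS' hYδ hDYδ hDG hGo hSc hfa'
  have hK' : HasMaj (BlockNorm.ofBlocks (unitTorusGeo L K M) (fun i : Tor (fine (L ^ n * L ^ K) M) × Fin (d + 1) => blockOf (L ^ n * L ^ K) M i.1))
      (BlockNorm.ofBlocks (unitTorusGeo L K M) (fun i : Tor (fine (L ^ n * L ^ K) M) × Fin (d + 1) => blockOf (L ^ n * L ^ K) M i.1)) Mf
      (fun y y' => β * r * (2 * (d : ℝ) + 3) * Real.exp (-(δ * tdistT M y y'))) := by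
    rw [hMf]
    exact hasMaj_fineStep L M K n hβ.le hr hG'f hSf hc' ha' hfa'
  have hDK : HasMaj (BlockNorm.ofBlocks (unitTorusGeo L K M) (blkFine L K M))
      (BlockNorm.ofBlocks (unitTorusGeo L K M) (fun i : Tor (fine (L ^ n * L ^ K) M) × Fin (d + 1) => blockOf (L ^ n * L ^ K) M i.1))
      (idef (pull (kingPrV L K n M)) (pull (kingPrV L K n M)) Mf Mc1)
      (fun y y' => β * r * (((d : ℝ) + 2) * ((((L ^ K : ℕ) : ℝ))⁻¹ + ((L : ℝ) ^ K) ^ (-(γ / 2))) + ((d : ℝ) + 1) * (((L ^ K : ℕ) : ℝ) ^ (-(1 / (8 * ((d : ℝ) + 1)))) +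
        ((L : ℝ) ^ K) ^ (-(γ / 2)))) * Real.exp (-(δ * tdistT M y y'))) := by
    rw [hMf, hMc1]
    exact hasMaj_idef_step L M K n hβ.le hθ hr hDG hGo hDSf hSfc hc' ha' hfa'
  have hDS : HasMaj (BlockNorm.ofBlocks (unitTorusGeo L K M) (blkFine L K M))
      (BlockNorm.ofBlocks (unitTorusGeo L K M) (fun i : Tor (fine (L ^ n * L ^ K) M) × Fin (d + 1) => blockOf (L ^ n * L ^ K) M i.1))
      (idef (pull (kingPrV L K n M)) (pull (kingPrV L K n M)) (G' ∘ₗ symbOp M (L ^ n * L ^ K) (((L ^ n * L ^ K : ℕ) : ℝ) • (sTinv M (L ^ n * L ^ K) κ - 1)))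
        (Y - Mc1 ∘ₗ Y))
      (fun y y' => (β * ((L : ℝ) ^ K) ^ (-(γ / 2)) + ((d : ℝ) + 1) * (β * cr * r * (B₂ * (((K : ℕ) : ℝ) + 2)) *
        ((2 * Real.exp δ + 3) * (((L ^ K : ℕ) : ℝ))⁻¹ + 2 * ((L : ℝ) ^ K) ^ (-(γ / 2))))) * Real.exp (-(δ / 2 * tdistT M y y'))) := by
    refine ((h3.sub hMis).congr fun v => ?_).mono fun y y' => le_of_eq ?_
    · have e := LinearMap.congr_fun hfixc v
      simp only [LinearMap.add_apply, LinearMap.comp_apply] at e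
      have e' := eq_sub_of_add_eq e.symm
      simp only [LinearMap.sub_apply, LinearMap.comp_apply, idef_apply]
      rw [e']
      simp only [map_sub]
      abel
    · rw [hcr_def]
      ring
  obtain ⟨M₀, hM₀, hap⟩ := exists_const_hasMaj_ofBlocks (g := unitTorusGeo L K M) (blkFine L K M)
    (fun i : Tor (fine (L ^ n * L ^ K) M) × Fin (d + 1) => blockOf (L ^ n * L ^ K) M i.1) (idef (pull (kingPrV L K n M)) (pull (kingPrV L K n M)) Y' Y)
  have hfix : Y = (Y - Mc1 ∘ₗ Y) + Mc1 ∘ₗ Y := (sub_add_cancel _ _).symm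
  have hm' := wrow_of_exp (ρ := δ / 2) hdd hrow (by positivity : (0 : ℝ) ≤ β * r * (2 * (d : ℝ) + 3)) (by linarith : δ / 2 + δ / 2 ≤ δ)
  have hmK := wrow_of_exp (ρ := δ / 2) hdd hrow (by positivity : (0 : ℝ) ≤ β * r * (((d : ℝ) + 2) * ((((L ^ K : ℕ) : ℝ))⁻¹ + ((L : ℝ) ^ K) ^ (-(γ / 2))) +
    ((d : ℝ) + 1) * (((L ^ K : ℕ) : ℝ) ^ (-(1 / (8 * ((d : ℝ) + 1)))) + ((L : ℝ) ^ K) ^ (-(γ / 2))))) (by linarith : δ / 2 + δ / 2 ≤ δ)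
  -- the Neumann guard `m′ = βr(2d+3)c_r ≤ ½`
  have h1 : (2 * W + 1)⁻¹ * (2 * W + 1) = 1 := inv_mul_cancel₀ (by positivity)
  have hqle : β * r * (2 * (d : ℝ) + 3) * cr ≤ (2 * W + 1)⁻¹ * W := by
    calc β * r * (2 * (d : ℝ) + 3) * cr = r * (β * (2 * (d : ℝ) + 3) * cr) := by ring
      _ ≤ (2 * W + 1)⁻¹ * (β * (2 * (d : ℝ) + 3) * cr) := mul_le_mul_of_nonneg_right hr_W (by positivity)
      _ = (2 * W + 1)⁻¹ * W := by rw [hW_def]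
  have hrW : (2 * W + 1)⁻¹ * W ≤ 1 / 2 := by nlinarith [inv_nonneg.mpr (by positivity : (0 : ℝ) ≤ 2 * W + 1)]
  have hq : β * r * (2 * (d : ℝ) + 3) * cr < 1 := by linarith
  have hq' : (BlockNorm.ofBlocks (unitTorusGeo L K M) (fun i : Tor (fine (L ^ n * L ^ K) M) × Fin (d + 1) => blockOf (L ^ n * L ^ K) M i.1)).κ *
      (β * r * (2 * (d : ℝ) + 3) * cr) < 1 := by rw [kappa_ofBlocks, one_mul]; exact hq
  have hq0 : 0 ≤ (1 - 1 * (β * r * (2 * (d : ℝ) + 3) * cr))⁻¹ := inv_nonneg.mpr (by linarith)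
  have hq2 : (1 - 1 * (β * r * (2 * (d : ℝ) + 3) * cr))⁻¹ ≤ 2 := by
    calc (1 - 1 * (β * r * (2 * (d : ℝ) + 3) * cr))⁻¹ ≤ (1 / 2)⁻¹ := inv_anti₀ (by norm_num) (by linarith)
      _ = 2 := by norm_num
  -- the device
  have key := idef_neumann_majorant_flat htri hdd hσ.le (by positivity) hA₀ hM₀ (fun _ _ => by positivity) hmK (fun _ _ => by positivity) hm'
    hfix hfix' hYρ hK' hDS hDK hap hq'
  refine key.mono fun y y' => ?_
  rw [kappa_ofBlocks, kappa_ofBlocks, unitTorusGeo_dist]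
  have hE := Real.exp_nonneg (-(δ / 2 * tdistT M y y'))
  have hbd := srcDivJet_const_bound (dd := (d : ℝ)) (Kp := ((K : ℕ) : ℝ) + 2) (E := Real.exp δ) hβ.le hcr hB₂.le (Real.exp_nonneg δ) hθ hx hr hr1 hil hilx
    (Nat.cast_nonneg d) hKp hq0 hq2
  rw [← hBt_def] at hbd
  calc (β * ((L : ℝ) ^ K) ^ (-(γ / 2)) + ((d : ℝ) + 1) * (β * cr * r * (B₂ * (((K : ℕ) : ℝ) + 2)) *
            ((2 * Real.exp δ + 3) * (((L ^ K : ℕ) : ℝ))⁻¹ + 2 * ((L : ℝ) ^ K) ^ (-(γ / 2)))) +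
          1 * (β * r * (((d : ℝ) + 2) * ((((L ^ K : ℕ) : ℝ))⁻¹ + ((L : ℝ) ^ K) ^ (-(γ / 2))) +
              ((d : ℝ) + 1) * (((L ^ K : ℕ) : ℝ) ^ (-(1 / (8 * ((d : ℝ) + 1)))) + ((L : ℝ) ^ K) ^ (-(γ / 2)))) * cr) * (B₂ * (((K : ℕ) : ℝ) + 2))) *
        (1 - 1 * (β * r * (2 * (d : ℝ) + 3) * cr))⁻¹ * Real.exp (-(δ / 2 * tdistT M y y'))
      ≤ Bt * (((K : ℕ) : ℝ) + 2) * (((L : ℝ) ^ K) ^ (-(γ / 2)) + r * ((L ^ K : ℕ) : ℝ) ^ (-(1 / (8 * ((d : ℝ) + 1))))) * Real.exp (-(δ / 2 * tdistT M y y')) :=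
        mul_le_mul_of_nonneg_right hbd hE

end Summit.QuantumFields.YangMills.BalabanUVNodes.N15.KingModel.SrcDiv

end
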